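import Literature.NumberTheory.Automorphic.BaseChangeArchimedean
import Literature.NumberTheory.Automorphic.ArchParameterUnique
import HarnessLib

/-!
# Descent of algebraicity and regularity along cyclic base change of prime degree
(Arthur–Clozel 1989, Ch. 3 Thm. 5.1 with Ch. 1 §7; consequences with the uniqueness of
archimedean parameters discharged)

Topic `NumberTheory/Automorphic`; theorems only, sibling of `BaseChangeArchimedean`. There,
`ArthurClozel1989_strongLifting_archimedean.isLAlgebraic_descent` (if the weak base change lift
`P` of `π` along `E/F` cyclic of prime degree is `L`-algebraic then so is `π`) takes as a
hypothesis the uniqueness of the archimedean parameter of `P` ("Harish-Chandra: the infinitesimal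
character determines the parameter"). That uniqueness is now a theorem of the tree
(`AutomorphicRepData.hasArchParameter_unique`, file `ArchParameterUnique`, from Harish-Chandra's
theorem proved in `HarishChandraGLExistence` / `HarishChandraGLIsomorphism`), so this file records
the hypothesis-free forms, still conditional on the named fact
`ArthurClozel1989_strongLifting_archimedean` (the archimedean clause of strong lifting) and on the
existence of an infinity type of `π` (`AutomorphicRepData.exists_hasInfinityType`, Clozel 1990
§3.3, passed as a hypothesis):

* `map_a_eq_of_comp_eq` — for ANY infinity types `T` of `π` and `T_P` of its lift `P`, the
  `z`-exponents of `T` at `σ` are those of `T_P` at every `τ ∣ σ` (the lift's parameter is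
  `τ ↦ χ_π(τ|_F)`, Arthur–Clozel Ch. 1 §7, and parameters are unique).
* `isLAlgebraic_descent'`, `isCAlgebraic_descent`, `isRegular_descent`,
  `isRegularAlgebraic_descent` — `L`- and `C`-algebraicity (Buzzard–Gee 2014, Def. 3.1.1; Clozel 1990,
  Déf. 1.8) and regularity (Clozel 1990, Déf. 3.12) of the lift `P` descend to `π`.

## References

* J. Arthur, L. Clozel, Ann. of Math. Stud. 120 (1989), Ch. 3 Thm. 5.1, Ch. 1 §7.
  [ArthurClozelAMS120]
* K. Buzzard, T. Gee, LMS Lecture Notes 414 (2014), Def. 3.1.1, §3.1. [BuzzardGee2014]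
* L. Clozel, *Motifs et formes automorphes* (1990), §3.3, Déf. 1.8, Déf. 3.12. [Clozel1990]
-/

noncomputable section

open scoped NumberField Classical
open NumberField

namespace Literature.NumberTheory.Automorphic

namespace ArthurClozel1989_strongLifting_archimedean

variable {n : ℕ} {F E : Type} [Field F] [NumberField F] [Field E] [NumberField E] [Algebra F E]
  [IsGalois F E] {hF : isCompact_glFiniteIntegralLevel n F}
  {hE : isCompact_glFiniteIntegralLevel n E}

/-- **Exponents of `π` at `σ` = exponents of its base change lift at any `τ ∣ σ`**, for arbitrary
infinity types `T` of `π` and `T_P` of `P`: the lift has the infinity type `τ ↦ T(τ|_F)`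
(`hasInfinityType_baseChange`, Arthur–Clozel Ch. 1 §7) and the `a`-multisets of an infinity type
are determined by the representation (`AutomorphicRepData.HasInfinityType.map_a_eq`).
[cite: ArthurClozelAMS120, Ch. 3 Thm. 5.1 and Ch. 1 §7] -/
theorem map_a_eq_of_comp_eq (h : ArthurClozel1989_strongLifting_archimedean)
    (hcyc : IsCyclic (E ≃ₐ[F] E)) (hprime : (Module.finrank F E).Prime)
    {π : CuspidalAutomorphicRepData n F hF} {P : CuspidalAutomorphicRepData n E hE}
    (hBC : IsWeakBaseChangeLiftAE π.1 P.1) {T : InfinityType F n} {TP : InfinityType E n}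
    (hT : π.1.HasInfinityType T) (hTP : P.1.HasInfinityType TP) {σ : F →+* ℂ} {τ : E →+* ℂ}
    (hτ : τ.comp (algebraMap F E) = σ) :
    (T σ).map ArchWeight.a = (TP τ).map ArchWeight.a := by
  have e := AutomorphicRepData.HasInfinityType.map_a_eq P.1
    (h.hasInfinityType_baseChange hcyc hprime hBC hT) hTP τ
  rwa [InfinityType.baseChange_apply, hτ] at e

/-- **`L`-algebraicity descends** along weak base change (cyclic, prime degree), with the
uniqueness hypothesis of `isLAlgebraic_descent` discharged by
`AutomorphicRepData.hasArchParameter_unique`; still granted an infinity type of `π`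
(`AutomorphicRepData.exists_hasInfinityType`, Clozel 1990 §3.3).
[cite: ArthurClozelAMS120, Ch. 3 Thm. 5.1 and Ch. 1 §7] [cite: BuzzardGee2014, Def. 3.1.1] -/
theorem isLAlgebraic_descent' (h : ArthurClozel1989_strongLifting_archimedean)
    (hcyc : IsCyclic (E ≃ₐ[F] E)) (hprime : (Module.finrank F E).Prime)
    {π : CuspidalAutomorphicRepData n F hF} {P : CuspidalAutomorphicRepData n E hE}
    (hBC : IsWeakBaseChangeLiftAE π.1 P.1) (hex : π.1.exists_hasInfinityType)
    (hP : P.1.IsLAlgebraic) : π.1.IsLAlgebraic :=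
  h.isLAlgebraic_descent hcyc hprime hBC hex
    (fun _ _ h₁ h₂ => AutomorphicRepData.hasArchParameter_unique P.1 h₁ h₂) hP

/-- **`C`-algebraicity descends**: if some infinity type of the lift `P` is `C`-algebraic
(exponents in `(n-1)/2 + ℤ`, Clozel's "algébrique") then every infinity type `T` of `π` is:
its `a`-exponents at `σ` are `a`-exponents of `P` at an extension `τ` of `σ`, and its
`b`-exponents at `σ` are `a`-exponents at `σ̄` (well-formedness).
[cite: ArthurClozelAMS120, Ch. 3 Thm. 5.1 and Ch. 1 §7] [cite: Clozel1990, Déf. 1.8] -/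
theorem isCAlgebraic_of_hasInfinityType (h : ArthurClozel1989_strongLifting_archimedean)
    (hcyc : IsCyclic (E ≃ₐ[F] E)) (hprime : (Module.finrank F E).Prime)
    {π : CuspidalAutomorphicRepData n F hF} {P : CuspidalAutomorphicRepData n E hE}
    (hBC : IsWeakBaseChangeLiftAE π.1 P.1) {T : InfinityType F n} {TP : InfinityType E n}
    (hT : π.1.HasInfinityType T) (hTP : P.1.HasInfinityType TP) (hC : TP.IsCAlgebraic) :
    T.IsCAlgebraic := by
  have ha : ∀ σ : F →+* ℂ, ∀ p ∈ T σ, ∃ k : ℤ, p.a = k + ((n : ℂ) - 1) / 2 := by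
    intro σ p hp
    obtain ⟨τ, hτ⟩ := exists_comp_algebraMap_eq (E := E) σ
    have hmem : p.a ∈ (TP τ).map ArchWeight.a := by
      rw [← map_a_eq_of_comp_eq h hcyc hprime hBC hT hTP hτ]
      exact Multiset.mem_map_of_mem _ hp
    obtain ⟨q, hq, hqa⟩ := Multiset.mem_map.mp hmem
    obtain ⟨k, -, hk, -⟩ := hC τ q hq
    exact ⟨k, by rw [← hqa, hk]⟩
  intro σ p hp
  obtain ⟨k, hk⟩ := ha σ p hp
  have hswap : p.swap ∈ T (ComplexEmbedding.conjugate σ) := by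
    rw [hT.1.2 σ]
    exact Multiset.mem_map_of_mem _ hp
  obtain ⟨l, hl⟩ := ha _ _ hswap
  exact ⟨k, l, hk, by simpa using hl⟩

/-- **`C`-algebraicity descends** along weak base change (cyclic, prime degree), granted an
infinity type of `π`. [cite: ArthurClozelAMS120, Ch. 3 Thm. 5.1 and Ch. 1 §7]
[cite: Clozel1990, Déf. 1.8] -/
theorem isCAlgebraic_descent (h : ArthurClozel1989_strongLifting_archimedean)
    (hcyc : IsCyclic (E ≃ₐ[F] E)) (hprime : (Module.finrank F E).Prime)
    {π : CuspidalAutomorphicRepData n F hF} {P : CuspidalAutomorphicRepData n E hE}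
    (hBC : IsWeakBaseChangeLiftAE π.1 P.1) (hex : π.1.exists_hasInfinityType)
    (hP : P.1.IsCAlgebraic) : π.1.IsCAlgebraic := by
  obtain ⟨T, hT⟩ := hex
  obtain ⟨TP, hTP, hC⟩ := hP
  exact ⟨T, hT, isCAlgebraic_of_hasInfinityType h hcyc hprime hBC hT hTP hC⟩

/-- **Regularity descends**: if some infinity type of the lift `P` is regular (pairwise distinct
`a`-exponents at each embedding, Clozel Déf. 3.12) then every infinity type of `π` is (its
`a`-multiset at `σ` is that of `P` at any `τ ∣ σ`).
[cite: ArthurClozelAMS120, Ch. 3 Thm. 5.1 and Ch. 1 §7] [cite: Clozel1990, Définition 3.12] -/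
theorem isRegular_of_hasInfinityType (h : ArthurClozel1989_strongLifting_archimedean)
    (hcyc : IsCyclic (E ≃ₐ[F] E)) (hprime : (Module.finrank F E).Prime)
    {π : CuspidalAutomorphicRepData n F hF} {P : CuspidalAutomorphicRepData n E hE}
    (hBC : IsWeakBaseChangeLiftAE π.1 P.1) {T : InfinityType F n} {TP : InfinityType E n}
    (hT : π.1.HasInfinityType T) (hTP : P.1.HasInfinityType TP) (hreg : TP.IsRegular) :
    T.IsRegular := by
  intro σ
  obtain ⟨τ, hτ⟩ := exists_comp_algebraMap_eq (E := E) σ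
  rw [map_a_eq_of_comp_eq h hcyc hprime hBC hT hTP hτ]
  exact hreg τ

/-- **Regular algebraicity (Clozel) descends** along weak base change (cyclic, prime degree),
granted an infinity type of `π`. [cite: ArthurClozelAMS120, Ch. 3 Thm. 5.1 and Ch. 1 §7]
[cite: Clozel1990, Déf. 1.8 and Déf. 3.12] -/
theorem isRegularAlgebraic_descent (h : ArthurClozel1989_strongLifting_archimedean)
    (hcyc : IsCyclic (E ≃ₐ[F] E)) (hprime : (Module.finrank F E).Prime)
    {π : CuspidalAutomorphicRepData n F hF} {P : CuspidalAutomorphicRepData n E hE}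
    (hBC : IsWeakBaseChangeLiftAE π.1 P.1) (hex : π.1.exists_hasInfinityType)
    (hP : P.1.IsRegularAlgebraic) : π.1.IsRegularAlgebraic := by
  obtain ⟨T, hT⟩ := hex
  obtain ⟨TP, hTP, hC, hreg⟩ := hP
  exact ⟨T, hT, isCAlgebraic_of_hasInfinityType h hcyc hprime hBC hT hTP hC,
    isRegular_of_hasInfinityType h hcyc hprime hBC hT hTP hreg⟩

end ArthurClozel1989_strongLifting_archimedean

end Literature.NumberTheory.Automorphic
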